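import Mathlib
import Literature.Probability.Percolation.TwoPointFunction
import Literature.Probability.Percolation.LatticeSymmetry
import Literature.Probability.Percolation.InfiniteClusterDensity
import HarnessLib

/-!
# Crux `PercTreeValue.TetrahedronHarrisGap` (stmt-CriticalPhenomena-7799), line `SketchIdeator1`
# (corner-ball total covariance) — helpers for stub `stub_G`

Helper file for the crux skeleton `Cruxes/TetrahedronHarrisGap/Lines/SketchIdeator1.lean`
(lead prover-line-stmt-CriticalPhenomena-7799-0), `--supports stmt-CriticalPhenomena-7799`.
No new definitions; everything is stated in the tree's vocabulary (`tau`, `bondPercolation`,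
`zdGraph`, `criticalProbI`, `boxArm`).

The registered stub `stub_G` ("gluing-lite" / pointwise hyperscaling-lite for critical bond
percolation on `ℤ³`: `τ_{p_c}(0, a_r), τ_{p_c}(b_r, c_r) ≥ c₀ · P_{p_c}(boxArm (r/8+1) 0)²` with
`a_r = (r,r,0)`, `b_r = (r,0,r)`, `c_r = (0,r,r)`) is an OPEN statement — the `≤` half of the
hyperscaling relation `2β/ν ≤ d − 2 + η` in inequality form (false above six dimensions). This
file proves its PROVABLE symmetry half and the reduction of the stub to a single pair of points:

* `tau_iso` — automorphism invariance of the two-point function on `ℤ^d`,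
  `τ_p(φ x, φ y) = τ_p(x, y)` for `φ : zdGraph d ≃g zdGraph d` (`P_p` is invariant under `ω ↦ φ '' ω`,
  `bondPercolation_real_preimage_relabel_iso`, and `φ '' ·` transports `{x ↔ y}` to
  `{φ x ↔ φ y}`, `openGraph_relabel_adj_iff`; Grimmett 1999, §1.6);
* `tau_opposite_edge_eq` — `τ_p(b_r, c_r) = τ_p(0, a_r)`: translate by `−b_r`
  (`tau_eq_tau_zero_sub`) to get `τ_p(0, (−r, r, 0))`, then reflect `x₀ ↦ −x₀` (`reflectIso 0`);
* `stub_G_of_first` — hence `stub_G` follows from its first conjunct alone;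
* `stub_G_of_boxGluing_of_ballAverage` (via `stub_G_of_fullSpaceGluing_of_ballAverage`) — where the
  open half sits: `stub_G` follows from the crux `PercHyperscalingGluing.BoxGluing`
  (stmt-CriticalPhenomena-4643, statement inlined as a hypothesis; only its full-space weakening
  `π_n² ≤ C |Λ_n|⁻¹ Σ_{x∈Λ_n} τ(0,x)` is used) together with a ball-average comparability
  `|Λ_{r/8}|⁻¹ Σ_{x∈Λ_{r/8}} τ(0,x) ≤ C' τ(0,(r,r,0))` (Harnack/doubling-type regularity of `τ_{p_c}`;
  both hypotheses open on `ℤ³`), with `c₀ = (C C')⁻¹`.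
-/

noncomputable section

open MeasureTheory Literature.Probability.Percolation Literature.Probability.LatticeModels

namespace Summit.CriticalPhenomena.PercolationContinuityZ3.Theorems.TetrahedronHarrisGap

/-- **Automorphism invariance of the two-point function on `ℤ^d`**: `τ_p(φ x, φ y) = τ_p(x, y)`
for every graph automorphism `φ` of `ℤ^d` (`P_p ∘ (φ '' ·)⁻¹ = P_p`,
`bondPercolation_real_preimage_relabel_iso`, and `(φ '' ·)⁻¹ {φ x ↔ φ y} = {x ↔ y}` because the
open graph of `φ '' ω` is isomorphic to that of `ω` along `φ`, `openGraph_relabel_adj_iff`).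
(Grimmett 1999, §1.6, p. 16: invariance of `P_p` under the symmetries of the lattice.) -/
theorem tau_iso {d : ℕ} (φ : zdGraph d ≃g zdGraph d) (p : unitInterval) (x y : Site d) :
    tau d p (φ x) (φ y) = tau d p x y := by
  rw [tau_def, tau_def, ← bondPercolation_real_preimage_relabel_iso φ p (openConn (φ x) (φ y))]
  congr 1
  ext ω
  simp only [Set.mem_preimage, openConn, Set.mem_setOf_eq]
  let ψ : openGraph ω ≃g openGraph (BondConfig.relabel (sym2Equiv φ.toEquiv) ω) :=
    { toEquiv := φ.toEquiv
      map_rel_iff' := fun {a b} => openGraph_relabel_adj_iff φ.toEquiv ω a b }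
  exact ψ.reachable_iff

/-- **The two opposite edges of the tetrahedron `T_r` have the same two-point function**:
`τ_p((r,0,r), (0,r,r)) = τ_p(0, (r,r,0))` on `ℤ³`. Translate by `−(r,0,r)`
(`tau_eq_tau_zero_sub`: `τ_p(b_r, c_r) = τ_p(0, (−r, r, 0))`), then apply the reflection
`x₀ ↦ −x₀` (`reflectIso 0`, a graph automorphism of `ℤ³` fixing `0` and sending `(−r, r, 0)` to
`(r, r, 0)`) and `tau_iso`. -/
theorem tau_opposite_edge_eq :
    ∀ (p : unitInterval) (r : ℕ),
      tau 3 p ![(r : ℤ), 0, (r : ℤ)] ![0, (r : ℤ), (r : ℤ)] = tau 3 p 0 ![(r : ℤ), (r : ℤ), 0] := by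
  intro p r
  rw [tau_eq_tau_zero_sub]
  have h0 : (reflectIso (0 : Fin 3)) (0 : Site 3) = 0 := by
    rw [zdSignedPermIso_apply, Site.signedPerm_zero]
  have h1 : (reflectIso (0 : Fin 3)) (![0, (r : ℤ), (r : ℤ)] - ![(r : ℤ), 0, (r : ℤ)]) =
      ![(r : ℤ), (r : ℤ), 0] := by
    ext i
    fin_cases i <;> simp
  rw [← tau_iso (reflectIso (0 : Fin 3)) p 0 (![0, (r : ℤ), (r : ℤ)] - ![(r : ℤ), 0, (r : ℤ)]), h0, h1]

/-- **Reduction of `stub_G` to one pair of points.** By `tau_opposite_edge_eq` the two conjuncts of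
the registered stub `stub_G` coincide, so the stub follows from its first conjunct: if
`c₀ · P_{p_c}(boxArm (r/8+1) 0)² ≤ τ_{p_c}(0, (r,r,0))` eventually in `r`, then both
`c₀ · P_{p_c}(boxArm (r/8+1) 0)² ≤ τ_{p_c}(0, (r,r,0))` and
`c₀ · P_{p_c}(boxArm (r/8+1) 0)² ≤ τ_{p_c}((r,0,r), (0,r,r))` eventually in `r`. (The hypothesis
itself — pointwise hyperscaling-lite at `p_c(ℤ³)` — is open.) -/
theorem stub_G_of_first
    (h : ∃ c₀ : ℝ, 0 < c₀ ∧ ∃ r₀ : ℕ, ∀ r : ℕ, r₀ ≤ r →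
      c₀ * (bondPercolation (zdGraph 3) (criticalProbI 3)).real (boxArm (r / 8 + 1) (0 : Site 3)) ^ 2 ≤
        tau 3 (criticalProbI 3) 0 ![(r : ℤ), (r : ℤ), 0]) :
    ∃ c₀ : ℝ, 0 < c₀ ∧ ∃ r₀ : ℕ, ∀ r : ℕ, r₀ ≤ r →
      c₀ * (bondPercolation (zdGraph 3) (criticalProbI 3)).real (boxArm (r / 8 + 1) (0 : Site 3)) ^ 2 ≤
          tau 3 (criticalProbI 3) 0 ![(r : ℤ), (r : ℤ), 0] ∧
        c₀ * (bondPercolation (zdGraph 3) (criticalProbI 3)).real (boxArm (r / 8 + 1) (0 : Site 3)) ^ 2 ≤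
          tau 3 (criticalProbI 3) ![(r : ℤ), 0, (r : ℤ)] ![0, (r : ℤ), (r : ℤ)] := by
  obtain ⟨c₀, hc₀, r₀, hr⟩ := h
  refine ⟨c₀, hc₀, r₀, fun r hr₀ => ⟨hr r hr₀, ?_⟩⟩
  rw [tau_opposite_edge_eq]
  exact hr r hr₀

/-! ### Where the open half sits: `stub_G` from `BoxGluing` plus a ball-average comparability

The nearest existing named statement to `stub_G` is the crux `BoxGluing` of route
`PercHyperscalingGluing` (stmt-CriticalPhenomena-4643; its statement is INLINED verbatim below as the
hypothesis `hB`, not imported): `π_n² ≤ C |Λ_n|⁻¹ Σ_{x ∈ Λ_n} P_{p_c}(0 ↔ x inside Λ_{Kn})`, an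
AVERAGED gluing inequality. To reach the POINTWISE `stub_G` one needs in addition that the ball
average of `τ_{p_c}(0, ·)` over `Λ_{r/8}` is dominated by the point value at the corner `a_r = (r,r,0)`
(hypothesis `hH`, a Harnack/doubling-type regularity of the critical two-point function; in exponent
language automatic from `τ(x) ≍ |x|^{-(1+η)}` with `1 + η < 3`, unproved on `ℤ³`). The lemmas below are
the kernel-checked bookkeeping `BoxGluing ∧ H ⇒ stub_G` (through the full-space weakening of
`BoxGluing`), with `c₀ = (C C')⁻¹`; both hypotheses are open. -/

/-- `{0 ↔ ∂B(n+1)}` in the sense of `boxArm` (a vertex outside `Λ_n` entered by an open lattice edge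
from a vertex of `Λ_n` joined to `0` inside `Λ_n`) implies `{0 ↔ ∂ⁱⁿΛ_n inside Λ_n} = siteToBoundary 3 n`
(the last vertex inside lies on the inner vertex boundary). -/
-- adapted from Summits/CriticalPhenomena/PercolationContinuityZ3/Theorems/PercNonProliferationDensityWhp.lean
-- (`boxArm_succ_zero_subset_siteToBoundary`), restated here to keep this helper file's imports minimal.
theorem boxArm_succ_zero_subset_siteToBoundary' {d : ℕ} (n : ℕ) :
    boxArm (n + 1) (0 : Site d) ⊆ siteToBoundary d n := by
  rintro ω ⟨u, hu, u', hu', hadj, hc⟩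
  simp only [Nat.add_sub_cancel, Finset.mem_coe] at hu hu' hc
  refine ⟨u', ?_, ?_⟩
  · rw [mem_innerBoundary_iff]
    exact ⟨hu', u, hu, hadj.2⟩
  · rw [openConnIn_eq_openConnVia (Finset.mem_coe.2 (zero_mem_box d n))]
    refine openConnVia_mono_graph (fun a b hab => ?_) 0 u' hc
    rw [withinGraph_adj] at hab ⊢
    exact ⟨(SimpleGraph.top_adj a b).2 hab.1.ne, hab.2.1, hab.2.2⟩

/-- `{x ↔ y inside S} ⊆ {x ↔ y}`: a path of the open graph induced on `S` is a path of the open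
graph (the induced subgraph embeds, `SimpleGraph.Embedding.induce`). -/
-- adapted from Literature/Probability/Percolation/TreeGraphBound.lean (`openConnIn_subset_openConn`),
-- restated here to keep this helper file's imports minimal.
theorem openConnIn_subset_openConn' {V : Type*} (S : Set V) (x y : V) :
    (openConnIn S x y : Set (BondConfig V)) ⊆ openConn x y := by
  rintro ω ⟨hx, hy, h⟩
  exact h.map (SimpleGraph.Embedding.induce S).toHom

/-- **`stub_G` from full-space gluing and a ball-average comparability (conditional reduction).**
If (hF, "FullSpaceGluing", the full-space weakening of `PercHyperscalingGluing.BoxGluing`)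
`π_n² ≤ C |Λ_n|⁻¹ Σ_{x∈Λ_n} τ_{p_c}(0,x)` for `n ≥ 1`, `π_n = P_{p_c}(siteToBoundary 3 n)`, and (hH)
`|Λ_{r/8}|⁻¹ Σ_{x∈Λ_{r/8}} τ_{p_c}(0,x) ≤ C' τ_{p_c}(0,(r,r,0))` for `r ≥ r₀`, then `stub_G` holds with
`c₀ = (C C')⁻¹` from `max r₀ 8` on: `P(boxArm (r/8+1) 0) ≤ π_{r/8}`
(`boxArm_succ_zero_subset_siteToBoundary'`), chain the two hypotheses at `n = r/8 ≥ 1`, and get the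
second conjunct from `tau_opposite_edge_eq` (`stub_G_of_first`). Both hypotheses are open at `p_c(ℤ³)`. -/
theorem stub_G_of_fullSpaceGluing_of_ballAverage
    (hF : ∃ C : ℝ, 0 < C ∧ ∀ n : ℕ, 1 ≤ n →
      (bondPercolation (zdGraph 3) (criticalProbI 3)).real (siteToBoundary 3 n) ^ 2 ≤
        C * ((box 3 n).card : ℝ)⁻¹ * ∑ x ∈ box 3 n, tau 3 (criticalProbI 3) 0 x)
    (hH : ∃ C' : ℝ, 0 < C' ∧ ∃ r₀ : ℕ, ∀ r : ℕ, r₀ ≤ r →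
      ((box 3 (r / 8)).card : ℝ)⁻¹ * ∑ x ∈ box 3 (r / 8), tau 3 (criticalProbI 3) 0 x ≤
        C' * tau 3 (criticalProbI 3) 0 ![(r : ℤ), (r : ℤ), 0]) :
    ∃ c₀ : ℝ, 0 < c₀ ∧ ∃ r₀ : ℕ, ∀ r : ℕ, r₀ ≤ r →
      c₀ * (bondPercolation (zdGraph 3) (criticalProbI 3)).real (boxArm (r / 8 + 1) (0 : Site 3)) ^ 2 ≤
          tau 3 (criticalProbI 3) 0 ![(r : ℤ), (r : ℤ), 0] ∧
        c₀ * (bondPercolation (zdGraph 3) (criticalProbI 3)).real (boxArm (r / 8 + 1) (0 : Site 3)) ^ 2 ≤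
          tau 3 (criticalProbI 3) ![(r : ℤ), 0, (r : ℤ)] ![0, (r : ℤ), (r : ℤ)] := by
  apply stub_G_of_first
  obtain ⟨C, hC, hFn⟩ := hF
  obtain ⟨C', hC', r₀, hHr⟩ := hH
  refine ⟨(C * C')⁻¹, by positivity, max r₀ 8, fun r hr => ?_⟩
  have hr₀ : r₀ ≤ r := le_of_max_le_left hr
  have hr8 : 8 ≤ r := le_of_max_le_right hr
  set n : ℕ := r / 8 with hn
  have hn1 : 1 ≤ n := by omega
  set P := bondPercolation (zdGraph 3) (criticalProbI 3) with hP
  have hπσ : P.real (boxArm (n + 1) (0 : Site 3)) ≤ P.real (siteToBoundary 3 n) :=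
    measureReal_mono (boxArm_succ_zero_subset_siteToBoundary' n)
  have hπ0 : 0 ≤ P.real (boxArm (n + 1) (0 : Site 3)) := measureReal_nonneg
  have key : P.real (boxArm (n + 1) (0 : Site 3)) ^ 2 ≤
      C * C' * tau 3 (criticalProbI 3) 0 ![(r : ℤ), (r : ℤ), 0] :=
    calc P.real (boxArm (n + 1) (0 : Site 3)) ^ 2
        ≤ P.real (siteToBoundary 3 n) ^ 2 := pow_le_pow_left₀ hπ0 hπσ 2
      _ ≤ C * ((box 3 n).card : ℝ)⁻¹ * ∑ x ∈ box 3 n, tau 3 (criticalProbI 3) 0 x := hFn n hn1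
      _ = C * (((box 3 n).card : ℝ)⁻¹ * ∑ x ∈ box 3 n, tau 3 (criticalProbI 3) 0 x) := by ring
      _ ≤ C * (C' * tau 3 (criticalProbI 3) 0 ![(r : ℤ), (r : ℤ), 0]) :=
          mul_le_mul_of_nonneg_left (hHr r hr₀) hC.le
      _ = C * C' * tau 3 (criticalProbI 3) 0 ![(r : ℤ), (r : ℤ), 0] := by ring
  have hCC' : 0 < C * C' := mul_pos hC hC'
  calc (C * C')⁻¹ * P.real (boxArm (r / 8 + 1) (0 : Site 3)) ^ 2
      ≤ (C * C')⁻¹ * (C * C' * tau 3 (criticalProbI 3) 0 ![(r : ℤ), (r : ℤ), 0]) := by gcongr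
    _ = tau 3 (criticalProbI 3) 0 ![(r : ℤ), (r : ℤ), 0] := by
        rw [← mul_assoc, inv_mul_cancel₀ hCC'.ne', one_mul]

/-- **`stub_G` from `BoxGluing` and a ball-average comparability (conditional reduction).**
If (hB = `PercHyperscalingGluing.BoxGluing`, stmt-CriticalPhenomena-4643, statement inlined verbatim)
`π_n² ≤ C |Λ_n|⁻¹ Σ_{x∈Λ_n} P_{p_c}(0 ↔ x inside Λ_{Kn})` for `n ≥ 1`, and (hH)
`|Λ_{r/8}|⁻¹ Σ_{x∈Λ_{r/8}} τ_{p_c}(0,x) ≤ C' τ_{p_c}(0,(r,r,0))` for `r ≥ r₀`, then `stub_G` holds: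
`P(0 ↔ x inside Λ) ≤ τ(0,x)` (`openConnIn_subset_openConn'`) turns `BoxGluing` into the full-space
gluing hypothesis of `stub_G_of_fullSpaceGluing_of_ballAverage` (the box restriction and `K` play no
role for `stub_G`). Both hypotheses are open at `p_c(ℤ³)`. -/
theorem stub_G_of_boxGluing_of_ballAverage
    (hB : ∃ C : ℝ, ∃ K : ℕ, 0 < C ∧ 1 ≤ K ∧ ∀ n : ℕ, 1 ≤ n →
      (bondPercolation (zdGraph 3) (criticalProbI 3)).real (siteToBoundary 3 n) ^ 2 ≤
        C * ((box 3 n).card : ℝ)⁻¹ *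
          ∑ x ∈ box 3 n, (bondPercolation (zdGraph 3) (criticalProbI 3)).real
            (openConnIn ↑(box 3 (K * n)) 0 x))
    (hH : ∃ C' : ℝ, 0 < C' ∧ ∃ r₀ : ℕ, ∀ r : ℕ, r₀ ≤ r →
      ((box 3 (r / 8)).card : ℝ)⁻¹ * ∑ x ∈ box 3 (r / 8), tau 3 (criticalProbI 3) 0 x ≤
        C' * tau 3 (criticalProbI 3) 0 ![(r : ℤ), (r : ℤ), 0]) :
    ∃ c₀ : ℝ, 0 < c₀ ∧ ∃ r₀ : ℕ, ∀ r : ℕ, r₀ ≤ r →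
      c₀ * (bondPercolation (zdGraph 3) (criticalProbI 3)).real (boxArm (r / 8 + 1) (0 : Site 3)) ^ 2 ≤
          tau 3 (criticalProbI 3) 0 ![(r : ℤ), (r : ℤ), 0] ∧
        c₀ * (bondPercolation (zdGraph 3) (criticalProbI 3)).real (boxArm (r / 8 + 1) (0 : Site 3)) ^ 2 ≤
          tau 3 (criticalProbI 3) ![(r : ℤ), 0, (r : ℤ)] ![0, (r : ℤ), (r : ℤ)] := by
  refine stub_G_of_fullSpaceGluing_of_ballAverage ?_ hH
  obtain ⟨C, K, hC, hK, hBn⟩ := hB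
  refine ⟨C, hC, fun n hn => (hBn n hn).trans ?_⟩
  have hsum : ∑ x ∈ box 3 n, (bondPercolation (zdGraph 3) (criticalProbI 3)).real
        (openConnIn ↑(box 3 (K * n)) 0 x) ≤ ∑ x ∈ box 3 n, tau 3 (criticalProbI 3) 0 x :=
    Finset.sum_le_sum fun x _ => by
      rw [tau_def]; exact measureReal_mono (openConnIn_subset_openConn' _ 0 x)
  gcongr

end Summit.CriticalPhenomena.PercolationContinuityZ3.Theorems.TetrahedronHarrisGap

end
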